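import Literature.RingTheory.MvPolynomial.BihomogeneousCoefficients
import Mathlib.LinearAlgebra.LinearIndependent.Lemmas
import Mathlib.LinearAlgebra.Basis.VectorSpace
import Literature.RingTheory.KrullDimension.HomogeneousCommonZero
import HarnessLib

/-!
# Linear subspaces on which a cubic form vanishes: lines in `≥ 5`, planes in `≥ 9` variables

Over an algebraically closed field `k`, a cubic form `F ∈ k[x₀, …, x_N]` vanishes identically on
a `2`-dimensional subspace of `kᴺ⁺¹` as soon as `N ≥ 4`, and on a `3`-dimensional subspace as soon
as `N ≥ 8` (`exists_linearIndependent_two_eval_cubic_eq_zero`,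
`exists_linearIndependent_three_eval_cubic_eq_zero`, and the subspace forms
`exists_submodule_finrank_two_eval_cubic_eq_zero`, `exists_submodule_finrank_three_eval_cubic_eq_zero`):
**every cubic hypersurface in `ℙᴺ_k` contains a line if `N ≥ 4` and a plane if `N ≥ 8`.** This is
the elementary greedy bound; the sharp statement is Debarre–Manivel, Math. Ann. 312 (1998),
Thm. 2.1 (the Fano scheme `F_r(X)` of a degree-`d` hypersurface `X ⊆ ℙᴺ` is non-empty for every
`X` iff `C(d + r, r) ≤ (r + 1)(N - r)`, i.e. `N ≥ 6` for planes on cubics), which needs the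
dimension theory of the incidence correspondence over the Grassmannian and is not attempted.
The consumer in the tree is the existence of planes on smooth cubic `n`-folds, `n ≥ 7`
(`Literature.AlgebraicGeometry.Motives.Mboro2018_chowTwo_cubic`, input (c) of
`Mboro2018_chowTwo_cubic_of_primeCycle_inputs`).

## The greedy step (`exists_finCons_eval_eq_zero`)

If `F` vanishes on `W = span(w₀, …, w_{u-1})` (the `w_j` independent), a vector `y` extends `W`
to a `(u+1)`-dimensional subspace on which `F` vanishes iff `F(Σ_j s_j w_j + t y) = 0` for all
`s, t`. Expand `P := F(Σ_j s_j w_j + y) ∈ (k[y])[s]` along the `s`-monomials: `P` is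
*bihomogeneous of degree `3`* — its coefficient at `s^α` is a form of degree `3 - |α|` in `y`
(`isBihom_aeval`; the bookkeeping `isBihom_add/mul/prod/pow` is kept unbundled as a conjunction
to avoid a definition). If `y` is a common zero of the coefficients with `|α| < 3` then
`F(Σ s_j w_j + t y) = Σ_{|α| = 3} s^α · coeff_α = F(Σ s_j w_j) = 0`
(`eval_eval_smul_eq_of_isBihom`, via `φ(t • x) = tⁿ φ(x)`, `eval_smul_of_isHomogeneous`). Adding
the `u` linear forms `y ↦ (ψ y)_j` for a retraction `ψ` of `s ↦ Σ s_j w_j` (`eval_escapeForm`)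
forces `y ∉ W`. These are at most `#{α : |α| ≤ 2} + u = C(u+2, 2) + u` forms of POSITIVE degree
in `N + 1` variables (`card_le_of_degree_lt_three`, and `card_filter_fin_zero/one/two` = `1, 3, 6`
by `decide`), so they have a common non-trivial zero as soon as `C(u+2,2) + u < N + 1` — the
projective dimension theorem `Literature.RingTheory.KrullDimension.exists_ne_zero_common_zero_of_isHomogeneous`
(Krull's height theorem + Nullstellensatz). Steps `u = 0, 1, 2` need `N + 1 > 1, 4, 8`.

## References

* O. Debarre, L. Manivel, *Sur la variété des espaces linéaires contenus dans une intersection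
  complète*, Math. Ann. 312 (1998), Thm. 2.1. [DebarreManivel1998]
* J. Harris, *Algebraic Geometry: A First Course* (Springer GTM 133, 1992), Lecture 12, "Fano
  varieties" (the dimension count for linear spaces on hypersurfaces).
-/

noncomputable section

open _root_.MvPolynomial

namespace Literature.RingTheory.MvPolynomial

universe u

variable {k : Type u} [Field k]

/-! ### The substitution `x ↦ Σ_j s_j w_j + y` and its two-level evaluation -/

section Step

variable {N u : ℕ}

/-- Two-level evaluation of the substituted form: substituting `s := c` and then `y := v` in
`F(Σ_j s_j w_j + y) ∈ (k[y])[s]` gives `F(Σ_j c_j w_j + v)`. [folklore] -/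
theorem eval_eval_aeval_lin (w : Fin u → Fin (N + 1) → k) (F : MvPolynomial (Fin (N + 1)) k)
    (c : Fin u → k) (v : Fin (N + 1) → k) :
    eval v (eval (fun j => C (c j))
      (aeval (fun m : Fin (N + 1) =>
        (∑ j : Fin u, C (C (w j m)) * X j) + C (X m) :
          Fin (N + 1) → MvPolynomial (Fin u) (MvPolynomial (Fin (N + 1)) k)) F)) =
      eval (fun m => (∑ j, c j * w j m) + v m) F := by
  induction F using MvPolynomial.induction_on with
  | C a =>
    simp only [algHom_C]
    change eval v (eval (fun j => C (c j)) (C (C a))) = _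
    simp
  | add p q hp hq => simp only [map_add, hp, hq]
  | mul_X p m hp =>
    simp only [map_mul, hp, aeval_X, map_add, map_sum, eval_C, eval_X, mul_comm (c _)]

/-- Expansion of the two-level evaluation along the `s`-monomials:
`P(s := c)(y := v) = Σ_α (Π_j c_j^{α_j}) · (coeff_α P)(v)`. [folklore] -/
theorem eval_eval_eq_sum (P : MvPolynomial (Fin u) (MvPolynomial (Fin (N + 1)) k))
    (c : Fin u → k) (v : Fin (N + 1) → k) :
    eval v (eval (fun j => C (c j)) P) =
      ∑ α ∈ P.support, (∏ j, c j ^ α j) * eval v (coeff α P) := by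
  rw [eval_eq' (fun j => C (c j)) P, map_sum]
  refine Finset.sum_congr rfl fun α _ => ?_
  rw [map_mul, map_prod, mul_comm]
  simp only [map_pow, eval_C]

/-- **Verification step.** If `P ∈ (k[y])[s]` is bihomogeneous of degree `3` and `v` is a common
zero of its coefficients `coeff_α P` with `|α| < 3`, then `P(s := c)(y := t v)` does not depend on
`t`: it equals `P(s := c)(y := 0)` (the coefficients with `|α| = 3` are constants, those with
`|α| < 3` are forms of positive degree vanishing at `v`). [folklore] -/
theorem eval_eval_smul_eq_of_isBihom {P : MvPolynomial (Fin u) (MvPolynomial (Fin (N + 1)) k)}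
    (hP : ∀ α, (coeff α P).IsHomogeneous (3 - α.degree) ∧ (3 < α.degree → coeff α P = 0))
    {v : Fin (N + 1) → k} (hv : ∀ α ∈ P.support, α.degree < 3 → eval v (coeff α P) = 0)
    (c : Fin u → k) (t : k) :
    eval (t • v) (eval (fun j => C (c j)) P) =
      eval (0 : Fin (N + 1) → k) (eval (fun j => C (c j)) P) := by
  rw [eval_eval_eq_sum, eval_eval_eq_sum]
  refine Finset.sum_congr rfl fun α hα => ?_
  congr 1
  rw [eval_smul_of_isHomogeneous (hP α).1,
    show (0 : Fin (N + 1) → k) = (0 : k) • v from (zero_smul k v).symm,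
    eval_smul_of_isHomogeneous (hP α).1]
  by_cases hdeg : α.degree < 3
  · rw [hv α hα hdeg, mul_zero, mul_zero]
  · have h3 : 3 - α.degree = 0 := by omega
    rw [h3, pow_zero, pow_zero]

/-- The escape linear forms: for a linear map `ψ : kᴺ⁺¹ → kᵘ`, the polynomial
`E_j = Σ_m ψ(e_m)_j X_m` evaluates to `v ↦ (ψ v)_j`. [folklore] -/
theorem eval_escapeForm (ψ : (Fin (N + 1) → k) →ₗ[k] (Fin u → k)) (j : Fin u)
    (v : Fin (N + 1) → k) :
    eval v (∑ m : Fin (N + 1), C (ψ (Pi.single m 1) j) * X m) = ψ v j := by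
  classical
  simp only [map_sum, map_mul, eval_C, eval_X]
  have hv : v = ∑ m, v m • (Pi.single m (1 : k) : Fin (N + 1) → k) := by
    ext i
    simp [Finset.sum_apply, Pi.single_apply]
  conv_rhs => rw [hv, map_sum, Finset.sum_apply]
  refine Finset.sum_congr rfl fun m _ => ?_
  rw [map_smul, Pi.smul_apply, smul_eq_mul, mul_comm]

/-- The escape forms are linear forms. [folklore] -/
theorem isHomogeneous_escapeForm (ψ : (Fin (N + 1) → k) →ₗ[k] (Fin u → k)) (j : Fin u) :
    (∑ m : Fin (N + 1), C (ψ (Pi.single m 1) j) * X m :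
      MvPolynomial (Fin (N + 1)) k).IsHomogeneous 1 :=
  IsHomogeneous.sum _ _ _ fun _ _ => isHomogeneous_C_mul_X _ _

/-- Counting the conditions: the `s`-exponents of degree `≤ 2` in `u` variables inject into the
maps `Fin u → Fin 3` with sum `≤ 2` (`α ↦ (j ↦ min (α j) 2)`). [folklore] -/
theorem card_le_of_degree_lt_three (S : Finset (Fin u →₀ ℕ)) (hS : ∀ α ∈ S, α.degree < 3) :
    S.card ≤ (Finset.univ.filter (fun f : Fin u → Fin 3 => ∑ j, (f j : ℕ) ≤ 2)).card := by
  classical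
  have hle : ∀ α ∈ S, ∀ j, α j ≤ 2 := fun α hα j =>
    Nat.le_of_lt_succ (lt_of_le_of_lt (Finsupp.le_degree j α) (hS α hα))
  refine Finset.card_le_card_of_injOn (fun α j => (⟨min (α j) 2, by omega⟩ : Fin 3))
    (fun α hα => ?_) (fun α hα β hβ h => ?_)
  · rw [Finset.coe_filter]
    refine ⟨Finset.mem_univ _, ?_⟩
    have h1 : ∑ j, (min (α j) 2 : ℕ) = ∑ j, α j :=
      Finset.sum_congr rfl fun j _ => min_eq_left (hle α hα j)
    rw [h1, ← Finsupp.degree_eq_sum]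
    exact Nat.le_of_lt_succ (hS α hα)
  · ext j
    have hj := congr_fun h j
    simp only [Fin.mk.injEq] at hj
    rwa [min_eq_left (hle α hα j), min_eq_left (hle β hβ j)] at hj

/-- **The greedy step.** Let `F` be a cubic form on `kᴺ⁺¹`, `k` algebraically closed, vanishing
identically on the span of `u` linearly independent vectors `w₀, …, w_{u-1}`. If
`#{s-monomials of degree ≤ 2 in u variables} + u < N + 1`, there is a vector `y` independent of
the `w_j` such that `F` vanishes identically on `span(y, w₀, …, w_{u-1})`: the coefficients
`coeff_α F(Σ_j s_j w_j + y)`, `|α| ≤ 2`, are forms of positive degree `3 - |α|` in `y`, the `u`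
coordinates of `y` along the `w_j` (for a chosen retraction) are linear forms, and fewer than
`N + 1` forms of positive degree in `N + 1` variables have a common non-trivial zero
(`Literature.RingTheory.KrullDimension.exists_ne_zero_common_zero_of_isHomogeneous`). [folklore] -/
theorem exists_finCons_eval_eq_zero [IsAlgClosed k] {F : MvPolynomial (Fin (N + 1)) k}
    (hF : F.IsHomogeneous 3) {w : Fin u → Fin (N + 1) → k} (hw : LinearIndependent k w)
    (hvan : ∀ c : Fin u → k, eval (fun m => ∑ j, c j * w j m) F = 0)
    (hN : (Finset.univ.filter (fun f : Fin u → Fin 3 => ∑ j, (f j : ℕ) ≤ 2)).card + u < N + 1) :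
    ∃ y : Fin (N + 1) → k, LinearIndependent k (Fin.cons y w : Fin (u + 1) → Fin (N + 1) → k) ∧
      ∀ c : Fin (u + 1) → k,
        eval (fun m => ∑ j, c j * (Fin.cons y w : Fin (u + 1) → Fin (N + 1) → k) j m) F = 0 := by
  classical
  -- the substituted form `P = F(Σ_j s_j w_j + y)` and its bihomogeneity
  set P : MvPolynomial (Fin u) (MvPolynomial (Fin (N + 1)) k) :=
    aeval (fun m : Fin (N + 1) =>
      (∑ j : Fin u, C (C (w j m)) * X j) + C (X m) :
        Fin (N + 1) → MvPolynomial (Fin u) (MvPolynomial (Fin (N + 1)) k)) F with hP_def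
  have hP : ∀ α, (coeff α P).IsHomogeneous (3 - α.degree) ∧ (3 < α.degree → coeff α P = 0) := by
    refine isBihom_aeval hF _ fun m => ?_
    refine isBihom_add (isBihom_sum _ _ fun j _ => ?_)
      (isBihom_C_of_isHomogeneous_one (isHomogeneous_X k m))
    simpa using isBihom_mul (isBihom_C_C (σ := Fin u) (τ := Fin (N + 1)) (w j m))
      (isBihom_X (k := k) (τ := Fin (N + 1)) j)
  -- a retraction `ψ` of `c ↦ Σ_j c_j w_j`
  have hinj : Function.Injective (Fintype.linearCombination k w) :=
    linearIndependent_iff_injective_fintypeLinearCombination.mp hw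
  obtain ⟨ψ, hψ⟩ := LinearMap.exists_leftInverse_of_injective _ (LinearMap.ker_eq_bot.mpr hinj)
  -- the system of conditions: coefficients of `s`-degree `< 3` and the escape forms
  set S : Finset (Fin u →₀ ℕ) := P.support.filter (fun α => α.degree < 3) with hS_def
  have hS3 : ∀ α ∈ S, α.degree < 3 := fun α hα => (Finset.mem_filter.mp hα).2
  let g : ↥S ⊕ Fin u → MvPolynomial (Fin (N + 1)) k :=
    Sum.elim (fun α => coeff α.1 P) (fun j => ∑ m : Fin (N + 1), C (ψ (Pi.single m 1) j) * X m)
  let deg : ↥S ⊕ Fin u → ℕ := Sum.elim (fun α => 3 - α.1.degree) (fun _ => 1)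
  have hg : ∀ i, (g i).IsHomogeneous (deg i) := by
    rintro (α | j)
    · exact (hP α.1).1
    · exact isHomogeneous_escapeForm ψ j
  have hdeg : ∀ i, 0 < deg i := by
    rintro (α | j)
    · have := hS3 α.1 α.2
      change 0 < 3 - α.1.degree
      omega
    · exact Nat.one_pos
  have hcard : Fintype.card (↥S ⊕ Fin u) < N + 1 := by
    rw [Fintype.card_sum, Fintype.card_coe, Fintype.card_fin]
    exact lt_of_le_of_lt (Nat.add_le_add_right (card_le_of_degree_lt_three S hS3) u) hN
  obtain ⟨y, hy0, hy⟩ :=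
    Literature.RingTheory.KrullDimension.exists_ne_zero_common_zero_of_isHomogeneous g deg hg hdeg
      hcard
  have hyS : ∀ α ∈ P.support, α.degree < 3 → eval y (coeff α P) = 0 := fun α hα hd =>
    hy (Sum.inl ⟨α, Finset.mem_filter.mpr ⟨hα, hd⟩⟩)
  have hyψ : ψ y = 0 := by
    ext j
    rw [← eval_escapeForm ψ j y]
    exact hy (Sum.inr j)
  have hy_span : y ∉ Submodule.span k (Set.range w) := by
    intro hmem
    rw [← Fintype.range_linearCombination] at hmem
    obtain ⟨c, rfl⟩ := hmem
    have hc : ψ (Fintype.linearCombination k w c) = c := by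
      have := LinearMap.congr_fun hψ c
      simpa using this
    have hc0 : c = 0 := hc.symm.trans hyψ
    exact hy0 (by rw [hc0, map_zero])
  refine ⟨y, hw.finCons hy_span, fun c => ?_⟩
  -- `F` vanishes on `span(w) + k y`
  have key := eval_eval_smul_eq_of_isBihom hP hyS (fun j => c j.succ) (c 0)
  rw [hP_def, eval_eval_aeval_lin, eval_eval_aeval_lin] at key
  have h0 : eval (fun m => (∑ j, c j.succ * w j m) + (0 : Fin (N + 1) → k) m) F = 0 := by
    simpa using hvan (fun j => c j.succ)
  rw [h0] at key
  have hfun : (fun m => ∑ j, c j * (Fin.cons y w : Fin (u + 1) → Fin (N + 1) → k) j m) =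
      fun m => (∑ j, c j.succ * w j m) + (c 0 • y) m := by
    ext m
    rw [Fin.sum_univ_succ]
    simp only [Fin.cons_zero, Fin.cons_succ, Pi.smul_apply, smul_eq_mul]
    ring
  rw [hfun]
  exact key

/-- The start of the induction: a form of positive degree vanishes at the origin, i.e. on the
span of the empty family. [folklore] -/
theorem eval_eq_zero_of_fin_zero {F : MvPolynomial (Fin (N + 1)) k} (hF : F.IsHomogeneous 3)
    (c : Fin 0 → k) (w : Fin 0 → Fin (N + 1) → k) :
    eval (fun m => ∑ j, c j * w j m) F = 0 := by
  have h : (fun m : Fin (N + 1) => ∑ j : Fin 0, c j * w j m) = (0 : k) • (0 : Fin (N + 1) → k) := by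
    ext m; simp
  rw [h, eval_smul_of_isHomogeneous hF]
  simp

/-- The count for `u = 0`: one monomial (the empty one). [folklore] -/
theorem card_filter_fin_zero :
    (Finset.univ.filter (fun f : Fin 0 → Fin 3 => ∑ j, (f j : ℕ) ≤ 2)).card = 1 := by
  decide

/-- The count for `u = 1`: the monomials `1, s, s²`. [folklore] -/
theorem card_filter_fin_one :
    (Finset.univ.filter (fun f : Fin 1 → Fin 3 => ∑ j, (f j : ℕ) ≤ 2)).card = 3 := by
  decide

/-- The count for `u = 2`: there are `6` monomials of degree `≤ 2` in two variables. [folklore] -/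
theorem card_filter_fin_two :
    (Finset.univ.filter (fun f : Fin 2 → Fin 3 => ∑ j, (f j : ℕ) ≤ 2)).card = 6 := by
  decide

end Step

/-! ### Lines and planes on cubics -/

section Main

variable {N : ℕ}

/-- **A cubic form in `N + 1 ≥ 5` variables over an algebraically closed field vanishes
identically on a `2`-dimensional subspace** (every cubic hypersurface in `ℙᴺ`, `N ≥ 4`, contains
a line): two greedy steps, with `1 + 0 < N + 1` and `3 + 1 < N + 1` conditions. [folklore] -/
theorem exists_linearIndependent_two_eval_cubic_eq_zero [IsAlgClosed k] (hN : 4 ≤ N)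
    {F : MvPolynomial (Fin (N + 1)) k} (hF : F.IsHomogeneous 3) :
    ∃ w : Fin 2 → Fin (N + 1) → k, LinearIndependent k w ∧
      ∀ c : Fin 2 → k, eval (fun m => ∑ j, c j * w j m) F = 0 := by
  classical
  obtain ⟨y₀, h₀, hv₀⟩ := exists_finCons_eval_eq_zero (u := 0) hF
    (w := fun j => Fin.elim0 j) linearIndependent_empty_type
    (fun c => eval_eq_zero_of_fin_zero hF c _) (by rw [card_filter_fin_zero]; omega)
  obtain ⟨y₁, h₁, hv₁⟩ := exists_finCons_eval_eq_zero (u := 1) hF h₀ hv₀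
    (by rw [card_filter_fin_one]; omega)
  exact ⟨_, h₁, hv₁⟩

/-- **A cubic form in `N + 1 ≥ 9` variables over an algebraically closed field vanishes
identically on a `3`-dimensional subspace** (every cubic hypersurface in `ℙᴺ`, `N ≥ 8`, contains
a plane): a third greedy step with `6 + 2 < N + 1` conditions. The sharp range is `N ≥ 6`
(Debarre–Manivel, Math. Ann. 312 (1998), Thm. 2.1: `C(d + r, r) ≤ (r + 1)(N - r)`); the greedy
bound `N ≥ 8` is what the Mboro / cubic-eightfold consumers need. [folklore] -/
theorem exists_linearIndependent_three_eval_cubic_eq_zero [IsAlgClosed k] (hN : 8 ≤ N)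
    {F : MvPolynomial (Fin (N + 1)) k} (hF : F.IsHomogeneous 3) :
    ∃ w : Fin 3 → Fin (N + 1) → k, LinearIndependent k w ∧
      ∀ c : Fin 3 → k, eval (fun m => ∑ j, c j * w j m) F = 0 := by
  classical
  obtain ⟨w, hw, hv⟩ := exists_linearIndependent_two_eval_cubic_eq_zero (by omega) hF
  obtain ⟨y, hy, hvy⟩ := exists_finCons_eval_eq_zero (u := 2) hF hw hv
    (by rw [card_filter_fin_two]; omega)
  exact ⟨_, hy, hvy⟩

/-- From a vanishing family to a vanishing subspace. [folklore] -/
theorem exists_submodule_of_forall_eval_eq_zero {u : ℕ} {F : MvPolynomial (Fin (N + 1)) k}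
    {w : Fin u → Fin (N + 1) → k} (hw : LinearIndependent k w)
    (hv : ∀ c : Fin u → k, eval (fun m => ∑ j, c j * w j m) F = 0) :
    ∃ W : Submodule k (Fin (N + 1) → k), Module.finrank k W = u ∧ ∀ v ∈ W, eval v F = 0 := by
  refine ⟨Submodule.span k (Set.range w), ?_, fun v hv' => ?_⟩
  · rw [finrank_span_eq_card hw, Fintype.card_fin]
  · rw [← Fintype.range_linearCombination] at hv'
    obtain ⟨c, rfl⟩ := hv'
    have h : (Fintype.linearCombination k w c : Fin (N + 1) → k) = fun m => ∑ j, c j * w j m := by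
      ext m
      simp [Fintype.linearCombination_apply, Finset.sum_apply]
    rw [h]
    exact hv c

/-- **Every cubic form in at least `5` variables over an algebraically closed field vanishes on a
`2`-dimensional subspace** (subspace form). [folklore] -/
theorem exists_submodule_finrank_two_eval_cubic_eq_zero [IsAlgClosed k] (hN : 4 ≤ N)
    {F : MvPolynomial (Fin (N + 1)) k} (hF : F.IsHomogeneous 3) :
    ∃ W : Submodule k (Fin (N + 1) → k), Module.finrank k W = 2 ∧ ∀ v ∈ W, eval v F = 0 := by
  obtain ⟨w, hw, hv⟩ := exists_linearIndependent_two_eval_cubic_eq_zero hN hF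
  exact exists_submodule_of_forall_eval_eq_zero hw hv

/-- **Every cubic form in at least `9` variables over an algebraically closed field vanishes on a
`3`-dimensional subspace** (subspace form). [folklore] -/
theorem exists_submodule_finrank_three_eval_cubic_eq_zero [IsAlgClosed k] (hN : 8 ≤ N)
    {F : MvPolynomial (Fin (N + 1)) k} (hF : F.IsHomogeneous 3) :
    ∃ W : Submodule k (Fin (N + 1) → k), Module.finrank k W = 3 ∧ ∀ v ∈ W, eval v F = 0 := by
  obtain ⟨w, hw, hv⟩ := exists_linearIndependent_three_eval_cubic_eq_zero hN hF
  exact exists_submodule_of_forall_eval_eq_zero hw hv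

end Main

end Literature.RingTheory.MvPolynomial

end
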